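import Mathlib
import HarnessLib
import Literature.Analysis.FluidPDE.HardSphereDynamics
import Literature.Analysis.FluidPDE.LocalForecastCorrector
import Literature.MathematicalPhysics.KineticTheory.HardSphereEuler
import Literature.MathematicalPhysics.KineticTheory.BackwardCluster
import Summits.AtomisticToContinuum.HydrodynamicLimit.Theses.RelayRaceLocality

/-!
# Crux `RelayRaceLocality.GibbsLightCone` (stmt-AtomisticToContinuum-12501) — ideator 6, round 2:
first lemmas of the cards `ghost-needle-peeling` and `supersonic-front-shedding` (statements only;
each `def … : Prop` elaborates over tree declarations; nothing is asserted).
-/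

namespace Summit.AtomisticToContinuum.HydrodynamicLimit.Cruxes.GibbsLightCone.IdeatorSix

open Literature.Analysis.FluidPDE Literature.MathematicalPhysics.KineticTheory MeasureTheory Filter Set
open scoped ENNReal

/-- Kinetic length unit `ℓ_N = (N+1)^{-1/3} / σ²` (as in `Seams.lean`). -/
noncomputable def ell (σ : ℝ) (N : ℕ) : ℝ := (((N + 1 : ℕ) : ℝ) ^ (-(1 / 3 : ℝ))) / σ ^ 2

/-- FIRST LEMMA of card `ghost-needle-peeling` (deterministic, M-sized): erasing a particle that is
never in contact with anybody leaves a hard-sphere trajectory of the remaining `N` spheres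
(fields `mem/locFinite/pos_continuous/free/binary` of `IsHardSphereTrajectory` restrict, because the
erased particle takes part in no collision). Global-in-time form; the interval form on `[0, τ]` is the
one used (same proof on the restricted time axis). -/
def EraseUntouched : Prop :=
  ∀ (ε : ℝ) (N : ℕ) (γ : ℝ → Config (N + 1) (Fin 3) T3) (p : Fin (N + 1)),
    IsHardSphereTrajectory (Torus.geometry (Fin 3)) ε (N + 1) γ →
    (∀ t : ℝ, ∀ j : Fin (N + 1), j ≠ p → γ t ∉ contactSet (Torus.geometry (Fin 3)) (N + 1) ε p j) →
    IsHardSphereTrajectory (Torus.geometry (Fin 3)) ε ((Finset.univ.erase p).card)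
      (fun t => Config.restrictTo (Finset.univ.erase p) (γ t))

/-- GHOST-NEEDLE IDENTITY, set form (deterministic): on a good orbit, particle `p` is collision-free on
`[t₀, t₀ + τ]` iff every other particle stays at distance `≠ ε` — in fact `> ε` — from the FREE
continuation of `p`'s state at `t₀` (the "ghost needle"), and then the others' motion is the
`p`-erased hard-sphere trajectory (`EraseUntouched`) started from the `p`-erased datum, i.e. (given
`IsHardSphereTrajectory.unique`) a functional of the `p`-less system alone. Stated here as the
inclusion used for upper bounds. -/
def SurvivalSubsetGhostVoid : Prop :=
  ∀ (ε : ℝ) (N : ℕ) (Φ : HardSphereFlow (Torus.geometry (Fin 3)) ε (N + 1)) (p : Fin (N + 1))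
    (t₀ τ : ℝ), 0 ≤ τ → ∀ z ∈ Φ.good,
    (∀ u ∈ Set.Icc t₀ (t₀ + τ), ∀ j : Fin (N + 1), j ≠ p →
        Φ.flow u z ∉ contactSet (Torus.geometry (Fin 3)) (N + 1) ε p j) →
    ∀ u ∈ Set.Icc t₀ (t₀ + τ), ∀ j : Fin (N + 1), j ≠ p →
      ε < Torus.euclidDist (Φ.flow u z j).1
        (freeFlight (Torus.geometry (Fin 3)) (u - t₀) (Φ.flow t₀ z) p).1

/-- TARGET of card `ghost-needle-peeling` = the D2 seam in POLYNOMIAL form (`HotFlightDamping`'s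
`e^{-ηy}` weakened to `y^{-m}`, any `m`): under the invariant Gibbs law, a sphere that is hot
(speed `> A√θ`) at time `t₀` flies collision-free over a path LENGTH `T ℓ_N` with probability
`≤ C_m T^{-m}`, eventually in `N`, uniformly in the label, the start time and `T ≥ 1`. -/
def HotFlightSurvivalPoly : Prop :=
  ∀ a θ : ℝ, 0 < a → 0 < θ → ∃ σ₀ : ℝ, 0 < σ₀ ∧ ∃ A : ℝ, 0 ≤ A ∧ ∀ m : ℕ, ∃ C : ℝ,
    ∀ σ : ℝ, 0 < σ → σ < σ₀ →
    ∀ Φ : (N : ℕ) → HardSphereFlow (Torus.geometry (Fin 3)) (hsDiameter σ N) (N + 1),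
    ∀ᶠ N : ℕ in atTop, ∀ (p : Fin (N + 1)) (t₀ T : ℝ), 1 ≤ T →
      localGibbsLaw σ (fun _ => a) (fun _ => 0) (fun _ => θ) N (Φ N)
        {z | A * Real.sqrt θ < ‖((Φ N).flow t₀ z p).2‖ ∧
          ∀ u ∈ Set.Icc t₀ (t₀ + T * ell σ N / ‖((Φ N).flow t₀ z p).2‖), ∀ j : Fin (N + 1), j ≠ p →
            (Φ N).flow u z ∉ contactSet (Torus.geometry (Fin 3)) (N + 1) (hsDiameter σ N) p j}
        ≤ ENNReal.ofReal (C * T ^ (-(m : ℝ)))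

/-- TRANSFERRED FORM C⁺ of card `ghost-needle-peeling`: VOID PROBABILITY OF A DETERMINISTIC SUPERSONIC
NEEDLE in the UNPERTURBED stationary gas (any particle number `n N`, same diameter): the probability
that no sphere comes within `ε_N` of the moving point `x₀ + u v` during a run of length `T ℓ_N` is
`≤ C_m T^{-m}`. No tagged particle, no conditioning: a cylinder functional of the stationary flow
(the ghost-hit count `N_T`) with EXACT mean `ν(v) T` (moving-sphere Campbell), bounded through
`P(N_T = 0) ≤ E|N_T - νT|^{2m} / (νT)^{2m}`. -/
def GhostNeedleVoidPoly : Prop :=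
  ∀ a θ : ℝ, 0 < a → 0 < θ → ∃ σ₀ : ℝ, 0 < σ₀ ∧ ∃ A : ℝ, 0 ≤ A ∧ ∀ m : ℕ, ∃ C : ℝ,
    ∀ σ : ℝ, 0 < σ → σ < σ₀ → ∀ n : ℕ → ℕ,
    Tendsto (fun N => (n N : ℝ) * hsDiameter σ N ^ 3) atTop (nhds (σ ^ 3)) →
    ∀ Ψ : (N : ℕ) → HardSphereFlow (Torus.geometry (Fin 3)) (hsDiameter σ N) (n N),
    ∀ᶠ N : ℕ in atTop, ∀ (x₀ : T3) (v : V3), A * Real.sqrt θ < ‖v‖ → ∀ T : ℝ, 1 ≤ T →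
      particleLaw (Ψ N) (canonicalDensity (Torus.geometry (Fin 3)) (hsDiameter σ N) (n N)
          (localGibbsProfile (fun _ => a) (fun _ => (0 : V3)) (fun _ => θ)))
        {z | ∀ u ∈ Set.Icc 0 (T * ell σ N / ‖v‖), ∀ j : Fin (n N),
            hsDiameter σ N < Torus.euclidDist ((Ψ N).flow u z j).1
              (freeFlight (Torus.geometry (Fin 3)) u (fun _ : Fin 1 => (x₀, v)) 0).1}
        ≤ ENNReal.ofReal (C * T ^ (-(m : ℝ)))

/-- FIRST LEMMA of card `supersonic-front-shedding` (deterministic real analysis, M-sized): RECORDS OF A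
SUB-BALLISTIC PASSAGE PROFILE OCCUPY A POSITIVE FRACTION. If the first-passage profile `τ` of a chain
across `[0, W]` is monotone with total `τ W - τ 0 ≤ W / c`, and `c'' < c`, then the set of "record"
radii `ρ` — those from which EVERY earlier radius was reached at speed `≥ c''`
(`τ ρ - τ ρ' ≤ (ρ - ρ') / c''` for all `ρ' ≤ ρ`) — has measure `≥ W (1 - c''/c)`. At records the
chain is supersonic with respect to its whole past (the geometric source of DLR freshness). Proof:
the running maximum of `ρ/c'' - τ ρ` is `1/c''`-Lipschitz, rises by `≥ W/c'' - W/c`, and is locally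
constant off the record set. -/
def RecordSetLarge : Prop :=
  ∀ (W c c'' : ℝ), 0 < W → 0 < c'' → c'' < c → ∀ τ : ℝ → ℝ, Monotone τ → τ W - τ 0 ≤ W / c →
    W * (1 - c'' / c) ≤
      (volume {ρ : ℝ | ρ ∈ Set.Icc 0 W ∧ ∀ ρ' ∈ Set.Icc 0 ρ, τ ρ - τ ρ' ≤ (ρ - ρ') / c''}).toReal

/-- KINEMATIC HEART of card `supersonic-front-shedding` (deterministic, S-sized): subsonic debris never
re-enters the expanding ball. A path `x` with speed `≤ c₁` (Lipschitz) that starts outside the closed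
ball of radius `r₀ + slack` around `x₀` stays outside the ball of radius `r₀ + c₁ t` expanding at the
same speed… from INSIDE: precisely, the gap `dist (x t) x₀ - (r₀ + c₁ t)` is nonincreasing is FALSE in
general, but `dist (x t) x₀ ≤ dist (x 0) x₀ + c₁ t`, so a point starting INSIDE radius `r₀` is inside
radius `r₀ + c₁ t` at time `t`: energy shed into subsonic particles at a front point stays inside the
front's expanding wake ball and cannot be AHEAD of a front that advances faster than `c₁`. -/
def SubsonicStaysInWake : Prop :=
  ∀ (x : ℝ → V3) (x₀ : V3) (c₁ r₀ : ℝ), 0 ≤ c₁ → LipschitzWith (Real.toNNReal c₁) x →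
    dist (x 0) x₀ ≤ r₀ → ∀ t : ℝ, 0 ≤ t → dist (x t) x₀ ≤ r₀ + c₁ * t

example : True := trivial

end Summit.AtomisticToContinuum.HydrodynamicLimit.Cruxes.GibbsLightCone.IdeatorSix
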